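import Mathlib
import Summits.Ventures.PercRepro2.PMK5Deg3Kernel
import Summits.Ventures.PercRepro2.PMK5Deg4Kernel

/-!
# The six-digit slice certificates of the typed `K₃` base on `K₆` — the definitions (the graph, the nineteen tables)
(blind cell PercRepro2, mine-2 g29; the degree-5 rung of `PMK5Deg4Kernel.lean` / `PMK5Deg4Kernel5.lean` (mine-2 g28,
Theorem 29): the mark `a₃` joined to ALL five base vertices — `K₆`, fifteen edges; six sliced digits, Kronecker base `2^28`)

The graph: `K₅` on `o = 0, a₁ = 1, a₂ = 2, u = 3, b = 4` (edges `0..9`, lexicographic pairs) plus the vertex `a₃ = 5`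
joined to `o` (edge `10`), `a₁` (`11`), `a₂` (`12`), `u` (`13`) and `b` (`14`).  Configurations `ω : Fin 15 → Bool`;
connectivity on vertex bitmasks (`nb`, `step`, `reach` — five closure steps on six vertices — `conn`), all
kernel-accelerated.  The marks of the crux functional are `o = 0, a₁ = 1, a₂ = 2, a₃ = 5, b = 4`; p1's eight-term
kernel `K₃` splits on `Q = {a₁ ↮ a₂}` into ten positive and ten negative products of three `0/1` tables exactly as in
`PMK5Deg3Kernel.lean` (`tab`: the nineteen tables).  The six-digit slices live in `PMK5Deg5Kernel6.lean`.
-/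

namespace Summit.Ventures.PercRepro2

namespace Deg5

/-! ## The graph `K₆` and bitmask connectivity on six vertices -/

/-- First endpoint of edge `e` (lexicographic pairs of `K₅`, then the five `a₃`-edges `a₃o`, `a₃a₁`, `a₃a₂`, `a₃u`, `a₃b`). -/
def ea : Fin 15 → ℕ
  | 0 => 0 | 1 => 0 | 2 => 0 | 3 => 0 | 4 => 1 | 5 => 1 | 6 => 1 | 7 => 2 | 8 => 2 | 9 => 3 | 10 => 0 | 11 => 1
  | 12 => 2 | 13 => 3 | 14 => 4

/-- Second endpoint of edge `e` (the five attachment edges end at `a₃ = 5`). -/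
def eb : Fin 15 → ℕ
  | 0 => 1 | 1 => 2 | 2 => 3 | 3 => 4 | 4 => 2 | 5 => 3 | 6 => 4 | 7 => 3 | 8 => 4 | 9 => 4 | 10 => 5 | 11 => 5
  | 12 => 5 | 13 => 5 | 14 => 5

/-- The neighbour bitmask of the vertex `u` in the open subgraph of `ω` (fifteen edges). -/
def nb (ω : Fin 15 → Bool) (u : ℕ) : ℕ :=
  (List.finRange 15).foldl (fun acc e =>
    if ω e then
      (if ea e = u then acc ||| (1 <<< eb e) else if eb e = u then acc ||| (1 <<< ea e) else acc)
    else acc) 0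

/-- One closure step on a vertex bitmask: add the open neighbours of every vertex of `R`. -/
def step (ω : Fin 15 → Bool) (R : ℕ) : ℕ :=
  (List.range 6).foldl (fun acc v => if R.testBit v then acc ||| nb ω v else acc) R

/-- The vertices reached from `u` (five steps suffice on six vertices). -/
def reach (ω : Fin 15 → Bool) (u : ℕ) : ℕ :=
  step ω (step ω (step ω (step ω (step ω (1 <<< u)))))

/-- Computable connectivity `u ↔ v` in the open subgraph of `ω`. -/
def conn (ω : Fin 15 → Bool) (u v : ℕ) : Bool := (reach ω u).testBit v

/-! ## The side tables (marks `o = 0, a₁ = 1, a₂ = 2, a₃ = 5, b = 4`) -/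

/-- `Q = {a₁ ↮ a₂}`. -/
def tQ (ω : Fin 15 → Bool) : Bool := !conn ω 1 2
/-- `L_v = {v ∈ C₁}`: `v` joined to `a₁ = 1`. -/
def tL (v : ℕ) (ω : Fin 15 → Bool) : Bool := conn ω 1 v
/-- `H_v = {v ∈ C₂}`: `v` joined to `a₂ = 2`. -/
def tH (v : ℕ) (ω : Fin 15 → Bool) : Bool := conn ω 2 v
/-- `U_v = {v ∈ C₁ ∪ C₂}`. -/
def tU (v : ℕ) (ω : Fin 15 → Bool) : Bool := tL v ω || tH v ω
/-- `u` and `v` on the same side: the positive part of `σ_u σ_v`. -/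
def tSame (u v : ℕ) (ω : Fin 15 → Bool) : Bool :=
  (tL u ω && tL v ω) || (tH u ω && tH v ω)
/-- `u` and `v` on opposite sides: the negative part of `σ_u σ_v`. -/
def tOpp (u v : ℕ) (ω : Fin 15 → Bool) : Bool :=
  (tL u ω && tH v ω) || (tH u ω && tL v ω)
/-- `PD = Q ∩ {a₃ ∉ C₁ ∪ C₂}`. -/
def tPD (ω : Fin 15 → Bool) : Bool := tQ ω && !tL 5 ω && !tH 5 ω
/-- `PD ∩ {o ∈ C₁ ∪ C₂}` (`f₃`). -/
def tPDoU (ω : Fin 15 → Bool) : Bool := tPD ω && tU 0 ω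

/-! ## The tables of the twelve functions -/

/-- `f₄⁺ = 1_Q 1_{o, b same side}`. -/
def t4p (ω : Fin 15 → Bool) : Bool := tQ ω && tSame 0 4 ω
/-- `f₄⁻ = 1_Q 1_{o, b opposite}`. -/
def t4m (ω : Fin 15 → Bool) : Bool := tQ ω && tOpp 0 4 ω
/-- `f₅⁺ = 1_Q 1_{a₃, b same side}`. -/
def t5p (ω : Fin 15 → Bool) : Bool := tQ ω && tSame 5 4 ω
/-- `f₅⁻ = 1_Q 1_{a₃, b opposite}`. -/
def t5m (ω : Fin 15 → Bool) : Bool := tQ ω && tOpp 5 4 ω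
/-- `f₆⁺ = 1_Q 1_{o∈U} 1_{a₃, b same side}`. -/
def t6p (ω : Fin 15 → Bool) : Bool := tQ ω && tU 0 ω && tSame 5 4 ω
/-- `f₆⁻ = 1_Q 1_{o∈U} 1_{a₃, b opposite}`. -/
def t6m (ω : Fin 15 → Bool) : Bool := tQ ω && tU 0 ω && tOpp 5 4 ω
/-- `f₇⁺` at `v`: `1_Q 1_{v∈C₁}` (`f₇` at `b = 4`, `f₈` at `o = 0`, `f₉` at `a₃ = 5`). -/
def t7p (v : ℕ) (ω : Fin 15 → Bool) : Bool := tQ ω && tL v ω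
/-- `f₇⁻` at `v`: `1_Q 1_{v∈C₂}`. -/
def t7m (v : ℕ) (ω : Fin 15 → Bool) : Bool := tQ ω && tH v ω
/-- `f₁₀⁺ = 1_Q 1_{a₃∈C₁} 1_{o∈U}`. -/
def t10p (ω : Fin 15 → Bool) : Bool := tQ ω && tL 5 ω && tU 0 ω
/-- `f₁₀⁻ = 1_Q 1_{a₃∈C₂} 1_{o∈U}`. -/
def t10m (ω : Fin 15 → Bool) : Bool := tQ ω && tH 5 ω && tU 0 ω
/-- `f₁₁ = 1_PD 1_{o∈U} 1_{b∈U}`. -/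
def t11 (ω : Fin 15 → Bool) : Bool := tPD ω && tU 0 ω && tU 4 ω
/-- `f₁₂ = 1_PD 1_{b∈U}`. -/
def t12 (ω : Fin 15 → Bool) : Bool := tPD ω && tU 4 ω

/-! ## The nineteen tables as a family -/

/-- The nineteen `0/1` tables of the split kernel, indexed: `0 Q, 1 PD, 2 PDoU, 3 t4p, 4 t4m, 5 t5p, 6 t5m, 7 t6p,
8 t6m, 9 t7p4, 10 t7m4, 11 t7p0, 12 t7m0, 13 t7p5, 14 t7m5, 15 t10p, 16 t10m, 17 t11, 18 t12`. -/
def tab : Fin 19 → (Fin 15 → Bool) → Bool :=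
  ![tQ, tPD, tPDoU, t4p, t4m, t5p, t5m, t6p,
    t6m, t7p 4, t7m 4, t7p 0, t7m 0, t7p 5, t7m 5,
    t10p, t10m, t11, t12]

end Deg5

end Summit.Ventures.PercRepro2
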